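import Mathlib
import HarnessLib

/-!
# Crux `HypercubicLimit` (stmt-QuantumFields-8646), line `conditional-mean-telescoping`: sub-goal `softScheme`

Support file (`--supports stmt-QuantumFields-8646`, c2 seat; leg (S) `stub_softLegs` of the closure, reshape 3): the
SEQUENCES of the scheme in units `a = m(β)`.  Given the rate `m > 0` with `m → 0` along `β → ∞`, a coupling threshold,
a spacing ceiling `a₀ > 0`, a torus demand `Λ(β, k)`, per-`(β, n)` torus thresholds `S₀(β, n)` and a physical size
`Λ₀`, there are couplings `β_k → ∞` above the thresholds and torus half-sides `L_k` with: `m(β_k) ≤ a₀`,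
`Λ(β_k, i) ≤ L_k` and `S₀(β_k, n) ≤ L_k` for all `i, n ≤ k` (diagonal growth: every fixed arity / index is served
eventually, and the torus demand of leg (R) survives the passage to a subsequence `φ k ≥ k`), `L_k ≥ m(β_k)⁻²`,
`Λ₀ ≤ m(β_k) L_k`, and `m(β_k) L_k → ∞`.  Elementary real analysis (no lattice object enters).
-/

set_option autoImplicit false

noncomputable section

open Filter Topology

namespace Summit.QuantumFields.YangMills.Cruxes.HypercubicLimit.ConditionalMeanTelescoping

/-- **`softScheme`** (registered sub-goal of crux stmt-QuantumFields-8646, c2 seat): the diagonal choice of couplings and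
torus sizes for the scheme in units `a = m(β)` — see the module docstring. -/
theorem softScheme :
    ∀ (m : ℝ → ℝ) (β₁ : ℝ), (∀ β : ℝ, β₁ ≤ β → 0 < m β) → Tendsto m atTop (𝓝 0) →
      ∀ (βthr a₀ : ℝ), 0 < a₀ → ∀ (Λ : ℝ → ℕ → ℕ) (S₀ : ℝ → ℕ → ℕ) (Λ₀ : ℝ),
        ∃ (βs : ℕ → ℝ) (Ls : ℕ → ℕ),
          (∀ k, βthr ≤ βs k) ∧ (∀ k, β₁ ≤ βs k) ∧ Tendsto βs atTop atTop ∧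
          (∀ k, 0 < m (βs k)) ∧ (∀ k, m (βs k) ≤ a₀) ∧ Tendsto (fun k => m (βs k)) atTop (𝓝 0) ∧
          (∀ k i : ℕ, i ≤ k → Λ (βs k) i ≤ Ls k) ∧ (∀ k n : ℕ, n ≤ k → S₀ (βs k) n ≤ Ls k) ∧
          (∀ k, (m (βs k))⁻¹ * (m (βs k))⁻¹ ≤ (Ls k : ℝ)) ∧ (∀ k, Λ₀ ≤ m (βs k) * Ls k) ∧
          Tendsto (fun k => m (βs k) * Ls k) atTop atTop := by
  intro m β₁ hpos hlim βthr a₀ ha₀ Λ S₀ Λ₀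
  classical
  -- a coupling threshold above which `m ≤ a₀`
  obtain ⟨βa, hβa⟩ : ∃ βa : ℝ, ∀ β, βa ≤ β → m β ≤ a₀ :=
    eventually_atTop.1 (hlim.eventually (Iic_mem_nhds ha₀))
  set β₀ : ℝ := max βthr (max β₁ βa) with hβ₀
  set βs : ℕ → ℝ := fun k => β₀ + k with hβs
  have hβs_ge : ∀ k, β₀ ≤ βs k := fun k => by simp [hβs]
  have hthr : ∀ k, βthr ≤ βs k := fun k => (le_max_left _ _).trans (hβs_ge k)
  have h₁ : ∀ k, β₁ ≤ βs k := fun k => ((le_max_left _ _).trans (le_max_right _ _)).trans (hβs_ge k)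
  have ha : ∀ k, βa ≤ βs k := fun k => ((le_max_right _ _).trans (le_max_right _ _)).trans (hβs_ge k)
  have hβlim : Tendsto βs atTop atTop := tendsto_atTop_add_const_left _ _ tendsto_natCast_atTop_atTop
  have hmpos : ∀ k, 0 < m (βs k) := fun k => hpos _ (h₁ k)
  have hma₀ : ∀ k, m (βs k) ≤ a₀ := fun k => hβa _ (ha k)
  have hmlim : Tendsto (fun k => m (βs k)) atTop (𝓝 0) := hlim.comp hβlim
  -- the torus half-sides: every demand up to index `k`, plus `⌈m⁻² + Λ₀/m⌉ + 1`
  set Ls : ℕ → ℕ := fun k =>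
    max ((Finset.range (k + 1)).sup fun i => Λ (βs k) i)
      (max ((Finset.range (k + 1)).sup fun n => S₀ (βs k) n)
        (⌈(m (βs k))⁻¹ * (m (βs k))⁻¹ + |Λ₀| / m (βs k)⌉₊ + 1)) with hLs
  have hΛ : ∀ k i : ℕ, i ≤ k → Λ (βs k) i ≤ Ls k := fun k i hi => by
    refine le_trans ?_ (le_max_left _ _)
    exact Finset.le_sup (f := fun i => Λ (βs k) i) (Finset.mem_range.2 (Nat.lt_succ_of_le hi))
  have hS₀ : ∀ k n : ℕ, n ≤ k → S₀ (βs k) n ≤ Ls k := fun k n hn => by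
    refine le_trans ?_ ((le_max_left _ _).trans (le_max_right _ _))
    exact Finset.le_sup (f := fun n => S₀ (βs k) n) (Finset.mem_range.2 (Nat.lt_succ_of_le hn))
  have hceil : ∀ k, (m (βs k))⁻¹ * (m (βs k))⁻¹ + |Λ₀| / m (βs k) ≤ (Ls k : ℝ) := fun k => by
    have h1 : ((⌈(m (βs k))⁻¹ * (m (βs k))⁻¹ + |Λ₀| / m (βs k)⌉₊ + 1 : ℕ) : ℝ) ≤ (Ls k : ℝ) := by
      exact_mod_cast (le_max_right _ _).trans (le_max_right _ _)
    refine le_trans ?_ h1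
    push_cast
    linarith [Nat.le_ceil ((m (βs k))⁻¹ * (m (βs k))⁻¹ + |Λ₀| / m (βs k))]
  have hinv : ∀ k, (m (βs k))⁻¹ * (m (βs k))⁻¹ ≤ (Ls k : ℝ) := fun k => by
    have : 0 ≤ |Λ₀| / m (βs k) := div_nonneg (abs_nonneg _) (hmpos k).le
    linarith [hceil k]
  have hΛ₀ : ∀ k, Λ₀ ≤ m (βs k) * Ls k := fun k => by
    have hm := hmpos k
    have h1 : |Λ₀| / m (βs k) ≤ Ls k := by
      have : 0 ≤ (m (βs k))⁻¹ * (m (βs k))⁻¹ := by positivity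
      linarith [hceil k]
    have h2 : |Λ₀| ≤ m (βs k) * Ls k := by
      rw [div_le_iff₀ hm] at h1; linarith
    exact (le_abs_self Λ₀).trans h2
  have hgrow : Tendsto (fun k => m (βs k) * Ls k) atTop atTop := by
    -- `m L ≥ m · m⁻² = m⁻¹ → ∞`
    have hlow : ∀ k, (m (βs k))⁻¹ ≤ m (βs k) * Ls k := fun k => by
      have hm := hmpos k
      have := mul_le_mul_of_nonneg_left (hinv k) hm.le
      rwa [← mul_assoc, mul_inv_cancel₀ hm.ne', one_mul] at this
    refine tendsto_atTop_mono hlow ?_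
    exact (tendsto_inv_nhdsGT_zero.comp
      (tendsto_nhdsWithin_iff.2 ⟨hmlim, Eventually.of_forall fun k => hmpos k⟩))
  exact ⟨βs, Ls, hthr, h₁, hβlim, hmpos, hma₀, hmlim, hΛ, hS₀, hinv, hΛ₀, hgrow⟩

end Summit.QuantumFields.YangMills.Cruxes.HypercubicLimit.ConditionalMeanTelescoping

end
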